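import Literature.NumberTheory.ModularSymbols.FullLevelHomologySpreadLattice
import Mathlib.LinearAlgebra.Eigenspace.Basic
import HarnessLib

/-!
# `H(N; ℚ) = ℚ ⊗ H₁(X₀(N), ℤ)` inside `S₂(Γ₀(N))^∨`: the rational dual embedding and the reduction of rational
# multiplicity one to a statement about cusp forms

Topic `Literature/NumberTheory/ModularSymbols`; namespace `Literature.NumberTheory.ModularSymbols`.  Definitions with bodies
(`ratDual`, `ratEval`) + proved theorems; no named fact, no `sorry`, no instance, no notation.

* `exists_eq_inv_tmul`: every element of `ℚ ⊗_ℤ M` is `d⁻¹ ⊗ x` (`d ≥ 1`, `x ∈ M`);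
* `ratDual N : H(N; ℚ) → S₂(Γ₀(N))^∨`, `r ⊗ x ↦ r·x` (`x ∈ Λ_N ⊂ S₂^∨` a period functional): `ratDual_tmul`, **injective**
  (`eq_zero_of_ratDual_eq_zero`), Hecke-equivariant for the transposed action (`ratDual_hecke`:
  `ratDual (hecke t v) = (ratDual v) ∘ t`), and compatible with generalised eigenvectors (`ratDual_pow_sub_apply_eq_zero`);
* `ratEval`: `ℚ ⊗ Λ_f → ℂ`, `r ⊗ λ ↦ r·λ`, injective (`eq_zero_of_ratEval_eq_zero`), with
  `(ratDual v)(f) = ratEval (periodClassK f v)` (`ratDual_apply_eq_ratEval`), so `periodClassK f v = 0 ↔ (ratDual v)(f) = 0`;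
* **`eq_zero_of_dualSeparation`**: RATIONAL (generalised) MULTIPLICITY ONE for `(f, (t_i, a_i)_{i ∈ s})` on `H(N; ℚ)` — the
  hypothesis `hMO1` of `Summit.…TeichmullerTwistDescent.KOfRationalMultOne` — follows from the DUAL SEPARATION statement on cusp
  forms: every `ψ ∈ S₂(Γ₀(N))^∨` killed by powers of the `(t_i^∨ − a_i)` and vanishing at `f` is zero (which is where
  Atkin–Lehner theory and strong multiplicity one enter; not proved here).

## References
* J. E. Cremona, *Algorithms for Modular Elliptic Curves* (1997), §2.1 (2.1.1)–(2.1.2), §2.10. [CremonaAlgorithms1997]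
* H. Darmon, F. Diamond, R. Taylor, *Fermat's Last Theorem* (1995), §1.3 (p. 32) (`𝕋` acts on `S₂^∨` by duality; `Λ ⊂ S₂^∨`).
  [DarmonDiamondTaylor1995]
-/

noncomputable section

namespace Literature.NumberTheory.ModularSymbols

open scoped MatrixGroups TensorProduct
open CongruenceSubgroup
open Literature.NumberTheory.EllipticCurves.ModularForms

/-! ### Denominators in `ℚ ⊗_ℤ M` -/

/-- Every element of `ℚ ⊗_ℤ M` is `d⁻¹ ⊗ x` with `d ≥ 1`. [cite: CremonaAlgorithms1997, §2.10] -/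
theorem exists_eq_inv_tmul {M : Type*} [AddCommGroup M] (t : ℚ ⊗[ℤ] M) :
    ∃ (d : ℕ) (x : M), d ≠ 0 ∧ t = ((d : ℚ)⁻¹) ⊗ₜ[ℤ] x := by
  induction t using TensorProduct.induction_on with
  | zero => exact ⟨1, 0, one_ne_zero, by simp⟩
  | tmul r x =>
    refine ⟨r.den, r.num • x, r.den_nz, ?_⟩
    rw [← TensorProduct.smul_tmul, zsmul_eq_mul, ← div_eq_mul_inv, Rat.num_div_den]
  | add t₁ t₂ h₁ h₂ =>
    obtain ⟨d₁, x₁, hd₁, rfl⟩ := h₁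
    obtain ⟨d₂, x₂, hd₂, rfl⟩ := h₂
    refine ⟨d₁ * d₂, (d₂ : ℤ) • x₁ + (d₁ : ℤ) • x₂, mul_ne_zero hd₁ hd₂, ?_⟩
    have e₁ : ((d₁ : ℚ))⁻¹ = (d₂ : ℤ) • ((d₁ * d₂ : ℕ) : ℚ)⁻¹ := by
      rw [zsmul_eq_mul]; push_cast; field_simp
    have e₂ : ((d₂ : ℚ))⁻¹ = (d₁ : ℤ) • ((d₁ * d₂ : ℕ) : ℚ)⁻¹ := by
      rw [zsmul_eq_mul]; push_cast; field_simp
    rw [TensorProduct.tmul_add, ← TensorProduct.smul_tmul, ← TensorProduct.smul_tmul, ← e₁, ← e₂]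

variable (N : ℕ) [NeZero N]

/-! ### The rational dual embedding `H(N; ℚ) ↪ S₂(Γ₀(N))^∨` -/

/-- **`ratDual : H(N; ℚ) = ℚ ⊗ Λ_N → S₂(Γ₀(N))^∨`**, `r ⊗ x ↦ r·x` (`Λ_N ⊂ S₂^∨` the period functionals).
[cite: DarmonDiamondTaylor1995, §1.3 (p. 32)] -/
def ratDual : CuspidalHomologyHeckeModule N ℚ →ₗ[ℤ] Module.Dual ℂ (CuspForm (Gamma0 N) 2) :=
  TensorProduct.lift
    (LinearMap.mk₂ ℤ (fun (r : ℚ) (x : periodHomologyHecke N) => (r : ℂ) • (x : Module.Dual ℂ (CuspForm (Gamma0 N) 2)))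
      (fun r₁ r₂ x => by rw [Rat.cast_add, add_smul])
      (fun n r x => by rw [zsmul_eq_mul, Rat.cast_mul, Rat.cast_intCast, mul_smul, Int.cast_smul_eq_zsmul])
      (fun r x₁ x₂ => by rw [Submodule.coe_add, smul_add])
      (fun n r x => by rw [Submodule.coe_smul_of_tower, smul_comm]))

/-- `ratDual (r ⊗ x) = r·x`. [cite: DarmonDiamondTaylor1995, §1.3 (p. 32)] -/
@[simp] theorem ratDual_tmul (r : ℚ) (x : periodHomologyHecke N) :
    ratDual N (r ⊗ₜ[ℤ] x) = (r : ℂ) • (x : Module.Dual ℂ (CuspForm (Gamma0 N) 2)) :=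
  TensorProduct.lift.tmul _ _

/-- **`ratDual` is injective**: `ratDual v = 0 → v = 0` (write `v = d⁻¹ ⊗ x`). [cite: DarmonDiamondTaylor1995, §1.3 (p. 32)] -/
theorem eq_zero_of_ratDual_eq_zero {v : CuspidalHomologyHeckeModule N ℚ} (hv : ratDual N v = 0) : v = 0 := by
  obtain ⟨d, x, hd, rfl⟩ := exists_eq_inv_tmul v
  rw [ratDual_tmul, smul_eq_zero] at hv
  rcases hv with h | h
  · exact absurd h (by rw [Rat.cast_inv, Rat.cast_natCast]; exact inv_ne_zero (Nat.cast_ne_zero.mpr hd))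
  · rw [show x = 0 from Subtype.ext h, TensorProduct.tmul_zero]

/-- **Hecke equivariance**: `ratDual (hecke t v) = (ratDual v) ∘ t` (the transposed action on `S₂^∨`).
[cite: DarmonDiamondTaylor1995, §1.3 (p. 32)] -/
theorem ratDual_hecke (t : HeckeRing0 N 2) (v : CuspidalHomologyHeckeModule N ℚ) :
    ratDual N (hecke N ℚ t v) = (ratDual N v) ∘ₗ HeckeRing0.toEnd N 2 t := by
  induction v using TensorProduct.induction_on with
  | zero => simp
  | add x y hx hy => rw [map_add, map_add, hx, hy, map_add, LinearMap.add_comp]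
  | tmul r x =>
    rw [hecke_tmul, ratDual_tmul, ratDual_tmul, LinearMap.smul_comp]
    congr 1

/-- `ratDual` commutes with `hecke t − a` (`a ∈ ℤ`). [cite: DarmonDiamondTaylor1995, §1.3 (p. 32)] -/
theorem ratDual_sub_apply (t : HeckeRing0 N 2) (a : ℤ) (v : CuspidalHomologyHeckeModule N ℚ) :
    ratDual N ((hecke N ℚ t - (a : ℚ) • 1) v) =
      ((HeckeRing0.toEnd N 2 t).dualMap - (a : ℂ) • 1) (ratDual N v) := by
  rw [LinearMap.sub_apply, LinearMap.sub_apply, map_sub, ratDual_hecke, LinearMap.dualMap_apply',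
    LinearMap.smul_apply, LinearMap.smul_apply, Module.End.one_apply, Module.End.one_apply, Int.cast_smul_eq_zsmul,
    map_zsmul, Int.cast_smul_eq_zsmul]

/-- **Generalised eigenvectors go to generalised eigenvectors**: `(hecke t − a)^k v = 0 ⇒ (t^∨ − a)^k (ratDual v) = 0`.
[cite: DarmonDiamondTaylor1995, §1.3 (p. 32)] -/
theorem ratDual_pow_sub_apply_eq_zero (t : HeckeRing0 N 2) (a : ℤ) (k : ℕ) (v : CuspidalHomologyHeckeModule N ℚ)
    (hv : ((hecke N ℚ t - (a : ℚ) • 1) ^ k) v = 0) :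
    (((HeckeRing0.toEnd N 2 t).dualMap - (a : ℂ) • 1) ^ k) (ratDual N v) = 0 := by
  have key : ∀ (k : ℕ) (v : CuspidalHomologyHeckeModule N ℚ),
      ratDual N (((hecke N ℚ t - (a : ℚ) • 1) ^ k) v) = (((HeckeRing0.toEnd N 2 t).dualMap - (a : ℂ) • 1) ^ k) (ratDual N v) := by
    intro k
    induction k with
    | zero => intro v; simp
    | succ k ih =>
      intro v
      rw [pow_succ, Module.End.mul_apply, ih, ratDual_sub_apply, ← Module.End.mul_apply, ← pow_succ]
  rw [← key, hv, map_zero]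

/-! ### Evaluation at `f`: `periodClassK` versus `ratDual` -/

omit [NeZero N] in
/-- **`ratEval : ℚ ⊗ Λ_f → ℂ`**, `r ⊗ λ ↦ r·λ`. [cite: CremonaAlgorithms1997, §2.10] -/
def ratEval (f : CuspForm (Gamma0 N) 2) : ℚ ⊗[ℤ] (periodLattice f).toIntSubmodule →ₗ[ℤ] ℂ :=
  TensorProduct.lift
    (LinearMap.mk₂ ℤ (fun (r : ℚ) (z : (periodLattice f).toIntSubmodule) => (r : ℂ) * (z : ℂ))
      (fun r₁ r₂ z => by rw [Rat.cast_add, add_mul])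
      (fun n r z => by rw [zsmul_eq_mul, Rat.cast_mul, Rat.cast_intCast, mul_assoc, ← zsmul_eq_mul])
      (fun r z₁ z₂ => by rw [Submodule.coe_add, mul_add])
      (fun n r z => by rw [Submodule.coe_smul_of_tower, zsmul_eq_mul, zsmul_eq_mul, mul_left_comm]))

omit [NeZero N] in
/-- `ratEval (r ⊗ λ) = r·λ`. [cite: CremonaAlgorithms1997, §2.10] -/
@[simp] theorem ratEval_tmul (f : CuspForm (Gamma0 N) 2) (r : ℚ) (z : (periodLattice f).toIntSubmodule) :
    ratEval N f (r ⊗ₜ[ℤ] z) = (r : ℂ) * (z : ℂ) :=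
  TensorProduct.lift.tmul _ _

omit [NeZero N] in
/-- `ratEval` is injective: `ratEval u = 0 → u = 0`. [cite: CremonaAlgorithms1997, §2.10] -/
theorem eq_zero_of_ratEval_eq_zero (f : CuspForm (Gamma0 N) 2) {u : ℚ ⊗[ℤ] (periodLattice f).toIntSubmodule}
    (hu : ratEval N f u = 0) : u = 0 := by
  obtain ⟨d, z, hd, rfl⟩ := exists_eq_inv_tmul u
  rw [ratEval_tmul, mul_eq_zero] at hu
  rcases hu with h | h
  · exact absurd h (by rw [Rat.cast_inv, Rat.cast_natCast]; exact inv_ne_zero (Nat.cast_ne_zero.mpr hd))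
  · rw [show z = 0 from Subtype.ext h, TensorProduct.tmul_zero]

/-- **`(ratDual v)(f) = ratEval (periodClassK f v)`**: evaluation at `f` of the rational dual embedding is the period class
map. [cite: CremonaAlgorithms1997, §2.10] -/
theorem ratDual_apply_eq_ratEval (f : CuspForm (Gamma0 N) 2) (v : CuspidalHomologyHeckeModule N ℚ) :
    ratDual N v f = ratEval N f (periodClassK N ℚ f v) := by
  induction v using TensorProduct.induction_on with
  | zero => simp
  | add x y hx hy => rw [map_add, map_add, map_add, LinearMap.add_apply, hx, hy]
  | tmul r x =>
    rw [ratDual_tmul, periodClassK_tmul, ratEval_tmul, LinearMap.smul_apply, coe_periodMapLattice, periodMap_apply,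
      smul_eq_mul]

/-- `periodClassK f v = 0 ↔ (ratDual v)(f) = 0`. [cite: CremonaAlgorithms1997, §2.10] -/
theorem periodClassK_eq_zero_iff (f : CuspForm (Gamma0 N) 2) (v : CuspidalHomologyHeckeModule N ℚ) :
    periodClassK N ℚ f v = 0 ↔ ratDual N v f = 0 := by
  rw [ratDual_apply_eq_ratEval]
  exact ⟨fun h => by rw [h, map_zero], fun h => eq_zero_of_ratEval_eq_zero N f h⟩

/-! ### Rational multiplicity one from dual separation -/

/-- **Rational (generalised) multiplicity one from DUAL SEPARATION.**  Let `t_i ∈ 𝕋` (`i ∈ s`), `a_i ∈ ℤ`, `f ∈ S₂(Γ₀(N))`.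
If every `ψ ∈ S₂(Γ₀(N))^∨` with `(t_i^∨ − a_i)^{k_i} ψ = 0` (`i ∈ s`) and `ψ(f) = 0` vanishes, then every
`v ∈ H(N; ℚ)` in the joint generalised `a`-eigenspace of the `hecke t_i` with `periodClassK f v = 0` vanishes — the shape of
hypothesis `hMO1` of the K-line (`t_i = T_{q_i}`, `heckeOp = hecke ∘ T`). [cite: DarmonDiamondTaylor1995, §1.3 (p. 32)] -/
theorem eq_zero_of_dualSeparation (f : CuspForm (Gamma0 N) 2) {ι : Type*} (s : Finset ι) (t : ι → HeckeRing0 N 2)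
    (a : ι → ℤ)
    (hDS : ∀ ψ : Module.Dual ℂ (CuspForm (Gamma0 N) 2),
      (∀ i ∈ s, ∃ k : ℕ, (((HeckeRing0.toEnd N 2 (t i)).dualMap - (a i : ℂ) • 1) ^ k) ψ = 0) → ψ f = 0 → ψ = 0)
    (v : CuspidalHomologyHeckeModule N ℚ)
    (hv : ∀ i ∈ s, v ∈ Module.End.maxGenEigenspace (hecke N ℚ (t i)) (a i : ℚ)) (hφ : periodClassK N ℚ f v = 0) :
    v = 0 := by
  refine eq_zero_of_ratDual_eq_zero N (hDS _ (fun i hi => ?_) ((periodClassK_eq_zero_iff N f v).mp hφ))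
  obtain ⟨k, hk⟩ := (Module.End.mem_maxGenEigenspace _ _ _).mp (hv i hi)
  exact ⟨k, ratDual_pow_sub_apply_eq_zero N (t i) (a i) k v hk⟩

/-- The same with the Hecke operators `T_{q_i}` (`heckeOp`), verbatim the `v`-clause of `hMO1`.
[cite: DarmonDiamondTaylor1995, §1.3 (p. 32)] -/
theorem eq_zero_of_dualSeparation_T (f : CuspForm (Gamma0 N) 2) {ι : Type*} (s : Finset ι) (q : ι → ℕ)
    (hq : ∀ i, (q i).Prime) (a : ι → ℤ)
    (hDS : ∀ ψ : Module.Dual ℂ (CuspForm (Gamma0 N) 2),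
      (∀ i ∈ s, ∃ k : ℕ, (((HeckeRing0.toEnd N 2 (HeckeRing0.T N 2 (q i) (hq i))).dualMap - (a i : ℂ) • 1) ^ k) ψ = 0) →
        ψ f = 0 → ψ = 0)
    (v : CuspidalHomologyHeckeModule N ℚ)
    (hv : ∀ i ∈ s, v ∈ Module.End.maxGenEigenspace (heckeOp N ℚ (q i) (hq i)) (a i : ℚ)) (hφ : periodClassK N ℚ f v = 0) :
    v = 0 :=
  eq_zero_of_dualSeparation N f s (fun i => HeckeRing0.T N 2 (q i) (hq i)) a hDS v
    (fun i hi => by rw [← heckeOp_def]; exact hv i hi) hφ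

end Literature.NumberTheory.ModularSymbols
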